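import Summits.ValiantsHypothesis.ValiantsHypothesis.Theorems.DefinabilityGapTopCorner
import Summits.ValiantsHypothesis.ValiantsHypothesis.Theorems.DefinabilityGapRegularSkeleton
import HarnessLib

/-!
# DefinabilityGap — the WINDOW CHAIN: the typed read-once reading of the top corner (kernel, all `m`)
Route `route-ValiantsHypothesis-DefinabilityGap` (decomp-valiant cycle 1, lens 5); helper of the read-once leaf F4 / W10
(`KIPlantedHittingRO`, stmt-ValiantsHypothesis-23704), census cell «(β) read-once reading of the top corner — PAPER-ONLY».
`P_c = kiPer m c`, `φ = bind₁ (kiPer m)`; a width-2 read-once block chain is `D = uᵀ · M_1(z_{c_1}) ⋯ M_N(z_{c_N}) · v`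
(`chainVal`, links `W2Link`, DISTINCT blocks, any order / length / univariate `2 × 2` links / boundary vectors).
THE OBJECT. For a LIVE WINDOW `W` of blocks and levels `t`, the WINDOW CHAIN `window W t l` keeps the live links and replaces every
FROZEN link `M_j(z)` by its CONSTANT coefficient matrix `[z^{t_j}] M_j` (`lead`). WINDOW IDENTITY (`coeff_add_frozenExp`, read-once
multilinearity): for `b` supported on `W`, `coeff (b + Σ_{frozen j} t_j [c_j]) D = coeff b (window chain)` — one `z_{c_j}`-power
extraction per link (`coeff_add_single_chainVal_cons`), possible because no other link reads `z_{c_j}`. Typed consequences: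
* `coeff_chainVal(_eq_skel)` — the read-once COEFFICIENT FORMULA `coeff a D = uᵀ · ∏_j [z^{a(c_j)}] M_j · v` (the layers of an
  ROABP are univariate polynomials with matrix coefficients), hence `degreeOf c_j D ≤ topDeg M_j` (`degreeOf_blk_le_topDeg`);
* ★ `kiPer_hits_of_window_ne_zero` — **WINDOW HITTING** (all `m`): `2·#W < m²`, `t_j ≥ topDeg M_j`, window chain `E ≠ 0`
  ⟹ `φ D ≠ 0`: a monomial `b` of `E` lies over `W` (`coeff_window_eq_zero`), so `a = b + Σ_frozen t_j[c_j]` is a monomial of `D`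
  of FULL degree `t_j = topDeg M_j = degreeOf c_j D` in every frozen variable, deficient only inside `W`, and
  `DefinabilityGapTopCorner.kiPer_hits_of_shallow_monomial` (the top corner of an annihilator of `G_m` is an annihilator) hits `D`;
  `kiPer_hits_window_eventually` is the K1 quantifier shape;
* ★ `kiPer_hits_scalarTop` — the cell-(β) EXAMPLE CLASS (`m ≥ 2`): every chain `uᵀ · ∏_j (z_{c_j}·I + N_j) · v` (any
  `N_j ∈ ℂ^{2×2}`) with SOME `uᵀ N_j v ≠ 0` is hit (window = the block `c_j`, window chain `uᵀ(z·I + N_j)v`), although for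
  nilpotent `N_j` its constant skeleton stalls on both sides (outside `DefinabilityGapRegularSkeleton` and the support rung).
HONEST GRADE. ELEMENTARY (read-once multilinearity; the coefficient formula is the standard matrix-coefficient reading of an ROABP) ·
KERNEL-NEW only as the chain-currency form of the top corner · 0 S-currency · closes no item · does NOT decide `RatioLeaf(m)` /
full width 2, `b ≥ 2`, K2, `KIAnnihilatorDefinableOnCollapse`, VP ≠ VNP. NOT CLAIMED: «`corner Wᶜ D` = top window chain» is FALSE
in general (`D = (1,0)·[[z,1],[0,0]]·[[0,0],[1,0]]·(1,0)ᵀ = 1`: corner `1`, top window chain `0`); typed is only «window chain `≠ 0`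
⇒ hit». RESIDUAL (β′), untouched: chains whose constant skeleton stalls on both sides AND whose window chain vanishes for every
co-small window (e.g. the `m = 2` counterexample family `(1,0)·∏[[1, ±z_b],[0,1]]·(0,1)ᵀ` of `DefinabilityGapWidthTwoAtTwo`: top
matrices `±E₁₂`, `E₁₂² = 0`). [cite: KabanetsImpagliazzo2003, Lemma 30] [cite: SahaSaptharishiSaxena2009, Lemma 2.1]
-/
noncomputable section
set_option linter.dupNamespace false
open MvPolynomial
open scoped Polynomial

namespace Summit.ValiantsHypothesis.ValiantsHypothesis.Theorems.DefinabilityGapWindowCorner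
open Summit.ValiantsHypothesis.ValiantsHypothesis.Theorems.DefinabilityGapAffineRung
open Summit.ValiantsHypothesis.ValiantsHypothesis.Theorems.DefinabilityGapZperTransfer
open Summit.ValiantsHypothesis.ValiantsHypothesis.Theorems.DefinabilityGapRatioLeaf
open Summit.ValiantsHypothesis.ValiantsHypothesis.Theorems.DefinabilityGapRegularSkeleton
open Summit.ValiantsHypothesis.ValiantsHypothesis.Theorems.DefinabilityGapTopCorner

/-! ## 0. Extracting one power of an unshared variable -/
section Coeff
variable {σ R : Type*} [CommSemiring R]
/-- A variable absent from `p` has exponent `0` in every monomial of `p`. [this file] -/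
theorem coeff_eq_zero_of_notMem_vars {p : MvPolynomial σ R} {c : σ} (hc : c ∉ p.vars) {d : σ →₀ ℕ}
    (hd : d c ≠ 0) : coeff d p = 0 :=
  notMem_support_iff.1 fun h => hc ((mem_vars_iff_mem_support c).2 ⟨d, h, Finsupp.mem_support_iff.2 hd⟩)
/-- ONE-POWER EXTRACTION: if no `G_t` reads `z_c` and `b_c = 0`, the coefficient of `b + s·[c]` in `Σ_{t<n} z_c^t · G_t` is
the coefficient of `b` in `G_s`. [this file] -/
theorem coeff_add_single_sum {c : σ} {b : σ →₀ ℕ} (hb : b c = 0) (G : ℕ → MvPolynomial σ R)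
    (hG : ∀ t, c ∉ (G t).vars) {s n : ℕ} (hs : s < n) :
    coeff (b + Finsupp.single c s) (∑ t ∈ Finset.range n, X c ^ t * G t) = coeff b (G s) := by
  rw [coeff_sum, Finset.sum_eq_single s]
  · rw [X_pow_eq_monomial, coeff_monomial_mul', if_pos (self_le_add_left _ _), one_mul, add_tsub_cancel_right]
  · intro t _ hts
    rw [X_pow_eq_monomial, coeff_monomial_mul']
    split_ifs with h
    · have ht : t ≤ s := by
        have h' := Finsupp.single_le_iff.1 h
        rwa [Finsupp.add_apply, hb, Finsupp.single_eq_same, zero_add] at h'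
      rw [one_mul]
      refine coeff_eq_zero_of_notMem_vars (hG t) ?_
      rw [Finsupp.tsub_apply, Finsupp.add_apply, hb, Finsupp.single_eq_same, Finsupp.single_eq_same, zero_add]
      omega
    · rfl
  · exact fun h => absurd (Finset.mem_range.2 hs) h
end Coeff
variable {m : ℕ}

/-! ## 1. Coefficient links, the window chain, the frozen exponent -/
/-- The top degree of a link: the largest degree of an entry of `M`. [this file] -/
def topDeg (L : W2Link m) : ℕ :=
  Finset.univ.sup fun ik : Fin 2 × Fin 2 => (L.M ik.1 ik.2).natDegree
/-- The level-`T` COEFFICIENT LINK of `L`: same block, constant link matrix `[z^T] M`. [this file] -/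
def lead (T : ℕ) (L : W2Link m) : W2Link m :=
  ⟨L.blk, L.M.map fun p => Polynomial.C (p.coeff T)⟩
/-- The WINDOW CHAIN: live links (block in `W`) kept, every frozen link replaced by its level-`t` coefficient link. [this file] -/
def window (W : Finset (Fin 3 → Fin (qOf m))) (t : W2Link m → ℕ) (l : List (W2Link m)) : List (W2Link m) :=
  l.map fun L => if L.blk ∈ W then L else lead (t L) L
/-- The FROZEN EXPONENT `Σ_{frozen L} t(L)·[blk L]`. [this file] -/
def frozenExp (W : Finset (Fin 3 → Fin (qOf m))) (t : W2Link m → ℕ) (l : List (W2Link m)) :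
    (Fin 3 → Fin (qOf m)) →₀ ℕ :=
  (l.map fun L => if L.blk ∈ W then 0 else Finsupp.single L.blk (t L)).sum
variable {W : Finset (Fin 3 → Fin (qOf m))} {t : W2Link m → ℕ}
/-- The empty window chain. [this file] -/
theorem window_nil : window W t ([] : List (W2Link m)) = [] := rfl
/-- Peeling the head of a window chain. [this file] -/
theorem window_cons (L : W2Link m) (rest : List (W2Link m)) :
    window W t (L :: rest) = (if L.blk ∈ W then L else lead (t L) L) :: window W t rest := rfl
/-- The empty frozen exponent. [this file] -/
theorem frozenExp_nil : frozenExp W t ([] : List (W2Link m)) = 0 := rfl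
/-- Peeling the head of a frozen exponent. [this file] -/
theorem frozenExp_cons (L : W2Link m) (rest : List (W2Link m)) :
    frozenExp W t (L :: rest) = (if L.blk ∈ W then 0 else Finsupp.single L.blk (t L)) + frozenExp W t rest := rfl
/-- The window chain reads the same block sequence. [this file] -/
theorem map_blk_window : ∀ l : List (W2Link m), (window W t l).map W2Link.blk = l.map W2Link.blk
  | [] => rfl
  | _ :: rest => by
    rw [window_cons, List.map_cons, List.map_cons, map_blk_window rest]
    split_ifs <;> rfl
/-- Every entry degree is at most the top degree. [this file] -/
theorem natDegree_le_topDeg (L : W2Link m) (i k : Fin 2) : (L.M i k).natDegree ≤ topDeg L :=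
  Finset.le_sup (f := fun ik : Fin 2 × Fin 2 => (L.M ik.1 ik.2).natDegree) (Finset.mem_univ (i, k))
/-- Peeling a coefficient link: `value([z^T]M :: ls)(u) = value(ls)(uᵀ[z^T]M)`. [this file] -/
theorem chainVal_cons_lead (T : ℕ) (L : W2Link m)
    (ls : List (Matrix (Fin 2) (Fin 2) (MvPolynomial (Fin 3 → Fin (qOf m)) ℂ))) (u v : Fin 2 → ℂ) :
    chainVal ((lead T L).mat :: ls) u v = chainVal ls (coeffVec L.M u T) v := by
  have h := chainVal_cons_ulink (lead T L).M (X (lead T L).blk) ls u v (n := 1) fun i k => by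
    show ((L.M.map fun p => Polynomial.C (p.coeff T)) i k).natDegree < 1
    rw [Matrix.map_apply, Polynomial.natDegree_C]
    exact Nat.zero_lt_one
  have hc : coeffVec (lead T L).M u 0 = coeffVec L.M u T := by
    funext k
    show ∑ i, u i * ((L.M.map fun p => Polynomial.C (p.coeff T)) i k).coeff 0 = ∑ i, u i * (L.M i k).coeff T
    simp only [Matrix.map_apply, Polynomial.coeff_C_zero]
  rw [W2Link.mat, h, Finset.sum_range_one, pow_zero, one_mul, hc]
/-- The constant-term matrix of a coefficient link is the coefficient matrix. [this file] -/
theorem constMat_lead (T : ℕ) (L : W2Link m) : constMat (lead T L) = L.M.map fun p => p.coeff T := by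
  ext i k
  simp [constMat, lead]
/-- Above the top degree the coefficient link vanishes. [this file] -/
theorem lead_mat_eq_zero {T : ℕ} {L : W2Link m} (h : topDeg L < T) : (lead T L).mat = 0 := by
  ext i k
  rw [W2Link.mat, ulink, Matrix.map_apply, Matrix.zero_apply]
  simp only [lead, Matrix.map_apply,
    Polynomial.coeff_eq_zero_of_natDegree_lt (lt_of_le_of_lt (natDegree_le_topDeg L i k) h), map_zero]
/-- A chain through a zero link vanishes. [this file] -/
theorem chainVal_eq_zero_of_zero_mem {σ R : Type*} [CommSemiring R]
    {ls : List (Matrix (Fin 2) (Fin 2) (MvPolynomial σ R))} (h : (0 : Matrix (Fin 2) (Fin 2) (MvPolynomial σ R)) ∈ ls)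
    (u v : Fin 2 → R) : chainVal ls u v = 0 := by
  simp [chainVal, List.prod_eq_zero h]
/-- The frozen exponent vanishes on the live window. [this file] -/
theorem frozenExp_apply_of_mem {c : Fin 3 → Fin (qOf m)} (hc : c ∈ W) :
    ∀ l : List (W2Link m), frozenExp W t l c = 0
  | [] => rfl
  | _ :: rest => by
    rw [frozenExp_cons, Finsupp.add_apply, frozenExp_apply_of_mem hc rest, add_zero]
    split_ifs with h
    · rfl
    · exact Finsupp.single_eq_of_ne fun hcL => h (hcL ▸ hc)
/-- The frozen exponent vanishes off the blocks of the chain. [this file] -/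
theorem frozenExp_apply_of_notMem {c : Fin 3 → Fin (qOf m)} :
    ∀ {l : List (W2Link m)}, c ∉ l.map W2Link.blk → frozenExp W t l c = 0
  | [], _ => rfl
  | _ :: _, hc => by
    rw [List.map_cons, List.mem_cons, not_or] at hc
    rw [frozenExp_cons, Finsupp.add_apply, frozenExp_apply_of_notMem hc.2, add_zero]
    split_ifs
    · rfl
    · exact Finsupp.single_eq_of_ne hc.1
/-- The frozen exponent of a frozen block is its level (distinct blocks). [this file] -/
theorem frozenExp_apply_blk {l : List (W2Link m)} (hl : (l.map W2Link.blk).Nodup) {L : W2Link m} (hL : L ∈ l)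
    (hW : L.blk ∉ W) : frozenExp W t l L.blk = t L := by
  induction l with
  | nil => cases hL
  | cons L' rest ih =>
    rw [List.map_cons, List.nodup_cons] at hl
    rw [frozenExp_cons, Finsupp.add_apply]
    rcases List.mem_cons.1 hL with rfl | hL'
    · rw [if_neg hW, Finsupp.single_eq_same, frozenExp_apply_of_notMem hl.1, add_zero]
    · have hne : L.blk ≠ L'.blk := fun h => hl.1 (List.mem_map.2 ⟨L, hL', h⟩)
      rw [ih hl.2 hL']
      split_ifs
      · rw [Finsupp.zero_apply, zero_add]
      · rw [Finsupp.single_eq_of_ne hne, zero_add]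
/-- HEAD EXTRACTION: the coefficient of `B + s·[c]` (`B_c = 0`) in `uᵀ M(z_c)·(tail)` is the coefficient of `B` in the tail
started at `uᵀ [z^s]M`, provided the tail does not read `z_c`. [this file] -/
theorem coeff_add_single_chainVal_cons (L : W2Link m)
    {ls : List (Matrix (Fin 2) (Fin 2) (MvPolynomial (Fin 3 → Fin (qOf m)) ℂ))} {v : Fin 2 → ℂ}
    (hls : ∀ u' : Fin 2 → ℂ, L.blk ∉ (chainVal ls u' v).vars) {B : (Fin 3 → Fin (qOf m)) →₀ ℕ} (hB : B L.blk = 0)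
    (u : Fin 2 → ℂ) (s : ℕ) :
    coeff (B + Finsupp.single L.blk s) (chainVal (L.mat :: ls) u v) = coeff B (chainVal ls (coeffVec L.M u s) v) := by
  have hdeg : ∀ i k, (L.M i k).natDegree < topDeg L + s + 1 := fun i k =>
    Nat.lt_succ_of_le ((natDegree_le_topDeg L i k).trans (Nat.le_add_right _ _))
  have hexp : chainVal (L.mat :: ls) u v =
      ∑ r ∈ Finset.range (topDeg L + s + 1), X L.blk ^ r * chainVal ls (coeffVec L.M u r) v :=
    chainVal_cons_ulink L.M (X L.blk) ls u v hdeg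
  rw [hexp]
  exact coeff_add_single_sum hB (fun r => chainVal ls (coeffVec L.M u r) v) (fun _ => hls _) (by omega)

/-! ## 2. The window identity -/
/-- **THE WINDOW IDENTITY** (read-once multilinearity): for distinct blocks and `b` supported on the live window `W`,
`coeff (b + frozenExp) D = coeff b (window chain)`. [this file] -/
theorem coeff_add_frozenExp (W : Finset (Fin 3 → Fin (qOf m))) (t : W2Link m → ℕ) :
    ∀ (l : List (W2Link m)), (l.map W2Link.blk).Nodup → ∀ (u v : Fin 2 → ℂ) (b : (Fin 3 → Fin (qOf m)) →₀ ℕ),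
      (∀ c, c ∉ W → b c = 0) →
        coeff (b + frozenExp W t l) (chainVal (l.map W2Link.mat) u v) =
          coeff b (chainVal ((window W t l).map W2Link.mat) u v)
  | [], _, _, _, _, _ => by rw [frozenExp_nil, add_zero, window_nil]
  | L :: rest, hl, _, v, b, hb => by
    rw [List.map_cons, List.nodup_cons] at hl
    have hvars : ∀ u' : Fin 2 → ℂ, L.blk ∉ (chainVal (rest.map W2Link.mat) u' v).vars := fun _ =>
      not_mem_vars_chainVal hl.1 _ _
    have hvarsW : ∀ u' : Fin 2 → ℂ, L.blk ∉ (chainVal ((window W t rest).map W2Link.mat) u' v).vars := fun _ =>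
      not_mem_vars_chainVal (by rw [map_blk_window]; exact hl.1) _ _
    rw [frozenExp_cons, window_cons, List.map_cons, List.map_cons]
    by_cases hLW : L.blk ∈ W
    · -- a LIVE link is kept: extract the power `b L.blk` on both sides
      have h0 : (Finsupp.erase L.blk b + frozenExp W t rest) L.blk = 0 := by
        rw [Finsupp.add_apply, Finsupp.erase_same, frozenExp_apply_of_mem hLW, add_zero]
      rw [if_pos hLW, if_pos hLW, zero_add, ← Finsupp.erase_add_single L.blk b, add_right_comm,
        coeff_add_single_chainVal_cons L hvars h0, coeff_add_single_chainVal_cons L hvarsW Finsupp.erase_same]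
      refine coeff_add_frozenExp W t rest hl.2 _ v _ fun c hc => ?_
      by_cases hcL : c = L.blk
      · rw [hcL, Finsupp.erase_same]
      · rw [Finsupp.erase_ne hcL, hb c hc]
    · -- a FROZEN link becomes its coefficient link: extract the power `t L` on the left
      have h0 : (b + frozenExp W t rest) L.blk = 0 := by
        rw [Finsupp.add_apply, hb _ hLW, frozenExp_apply_of_notMem hl.1, add_zero]
      rw [if_neg hLW, if_neg hLW, ← add_assoc, add_right_comm, coeff_add_single_chainVal_cons L hvars h0,
        chainVal_cons_lead, coeff_add_frozenExp W t rest hl.2 _ v b hb]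
/-- Off the live window the window chain is constant: its monomials live over `W`. [this file] -/
theorem coeff_window_eq_zero (W : Finset (Fin 3 → Fin (qOf m))) (t : W2Link m → ℕ) {c : Fin 3 → Fin (qOf m)}
    (hc : c ∉ W) :
    ∀ (l : List (W2Link m)), (l.map W2Link.blk).Nodup → ∀ (u v : Fin 2 → ℂ) (d : (Fin 3 → Fin (qOf m)) →₀ ℕ),
      d c ≠ 0 → coeff d (chainVal ((window W t l).map W2Link.mat) u v) = 0
  | [], _, _, _, _, hd => by
    rw [window_nil, List.map_nil, chainVal_nil, coeff_C, if_neg]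
    exact fun h => hd (by rw [← h, Finsupp.zero_apply])
  | L :: rest, hl, _, v, d, hd => by
    rw [List.map_cons, List.nodup_cons] at hl
    rw [window_cons, List.map_cons]
    by_cases hLW : L.blk ∈ W
    · have hne : c ≠ L.blk := fun h => hc (h ▸ hLW)
      have hvarsW : ∀ u' : Fin 2 → ℂ, L.blk ∉ (chainVal ((window W t rest).map W2Link.mat) u' v).vars := fun _ =>
        not_mem_vars_chainVal (by rw [map_blk_window]; exact hl.1) _ _
      rw [if_pos hLW, ← Finsupp.erase_add_single L.blk d, coeff_add_single_chainVal_cons L hvarsW Finsupp.erase_same]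
      exact coeff_window_eq_zero W t hc rest hl.2 _ v _ (by rwa [Finsupp.erase_ne hne])
    · rw [if_neg hLW, chainVal_cons_lead]
      exact coeff_window_eq_zero W t hc rest hl.2 _ v d hd

/-! ## 3. The coefficient formula and the degree bound -/
/-- With the empty window at levels `a ∘ blk` the frozen exponent is `a` itself. [this file] -/
theorem frozenExp_empty {l : List (W2Link m)} (hl : (l.map W2Link.blk).Nodup) {a : (Fin 3 → Fin (qOf m)) →₀ ℕ}
    (ha : ∀ c, c ∉ l.map W2Link.blk → a c = 0) : frozenExp ∅ (fun L => a L.blk) l = a := by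
  ext c
  by_cases hc : c ∈ l.map W2Link.blk
  · obtain ⟨L, hL, rfl⟩ := List.mem_map.1 hc
    exact frozenExp_apply_blk hl hL (Finset.notMem_empty _)
  · rw [frozenExp_apply_of_notMem hc, ha c hc]
/-- **THE READ-ONCE COEFFICIENT FORMULA**: `coeff a D` is the constant term of the all-frozen window chain at levels `a`,
i.e. `uᵀ · ∏_j [z^{a(c_j)}] M_j · v`. [this file] -/
theorem coeff_chainVal {l : List (W2Link m)} (hl : (l.map W2Link.blk).Nodup) {a : (Fin 3 → Fin (qOf m)) →₀ ℕ}
    (ha : ∀ c, c ∉ l.map W2Link.blk → a c = 0) (u v : Fin 2 → ℂ) :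
    coeff a (chainVal (l.map W2Link.mat) u v) =
      coeff 0 (chainVal ((window ∅ (fun L => a L.blk) l).map W2Link.mat) u v) := by
  have h := coeff_add_frozenExp ∅ (fun L => a L.blk) l hl u v 0 fun _ _ => rfl
  rwa [zero_add, frozenExp_empty hl ha] at h
/-- The same in skeleton form: `coeff a D = Σ_i u_i · (∏_j [z^{a(c_j)}] M_j · v)_i`. [this file] -/
theorem coeff_chainVal_eq_skel {l : List (W2Link m)} (hl : (l.map W2Link.blk).Nodup) {a : (Fin 3 → Fin (qOf m)) →₀ ℕ}
    (ha : ∀ c, c ∉ l.map W2Link.blk → a c = 0) (u v : Fin 2 → ℂ) :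
    coeff a (chainVal (l.map W2Link.mat) u v) = ∑ i, u i * skel (window ∅ (fun L => a L.blk) l) v i := by
  have e : ∀ p : MvPolynomial (Fin 3 → Fin (qOf m)) ℂ, coeff 0 p = constantCoeff p := fun _ => rfl
  rw [coeff_chainVal hl ha, e, chainVal_eq_col, map_add, map_mul, map_mul, constantCoeff_C, constantCoeff_C,
    constantCoeff_col, constantCoeff_col, Fin.sum_univ_two]
/-- **DEGREE BOUND**: in every monomial of a read-once chain the exponent of `z_{c_j}` is at most `topDeg M_j`. [this file] -/
theorem apply_blk_le_topDeg {l : List (W2Link m)} (hl : (l.map W2Link.blk).Nodup) {u v : Fin 2 → ℂ}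
    {a : (Fin 3 → Fin (qOf m)) →₀ ℕ} (ha : a ∈ (chainVal (l.map W2Link.mat) u v).support) {L : W2Link m}
    (hL : L ∈ l) : a L.blk ≤ topDeg L := by
  by_contra hlt
  rw [not_le] at hlt
  have ha0 : ∀ c, c ∉ l.map W2Link.blk → a c = 0 := fun c hc => by
    by_contra h
    exact mem_support_iff.1 ha (coeff_eq_zero_of_notMem_vars (not_mem_vars_chainVal hc u v) h)
  have hmem : (0 : Matrix (Fin 2) (Fin 2) (MvPolynomial (Fin 3 → Fin (qOf m)) ℂ)) ∈
      (window ∅ (fun L => a L.blk) l).map W2Link.mat :=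
    List.mem_map.2 ⟨lead (a L.blk) L, List.mem_map.2 ⟨L, hL, if_neg (Finset.notMem_empty _)⟩, lead_mat_eq_zero hlt⟩
  refine mem_support_iff.1 ha ?_
  rw [coeff_chainVal hl ha0, chainVal_eq_zero_of_zero_mem hmem, coeff_zero]
/-- The degree bound on `degreeOf`. [this file] -/
theorem degreeOf_blk_le_topDeg {l : List (W2Link m)} (hl : (l.map W2Link.blk).Nodup) (u v : Fin 2 → ℂ)
    {L : W2Link m} (hL : L ∈ l) : degreeOf L.blk (chainVal (l.map W2Link.mat) u v) ≤ topDeg L :=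
  degreeOf_le_iff.2 fun _ ha => apply_blk_le_topDeg hl ha hL

/-! ## 4. Window hitting -/
/-- ★ **WINDOW HITTING** (all `m`): a width-2 read-once block chain (distinct blocks; any order, length, links, boundary
vectors) whose window chain over a live window `W` with `2·#W < m²` — frozen links replaced by their level-`t ≥ topDeg`
coefficient links — is NONZERO is hit by `G_m`. (For `t_j > topDeg M_j` a frozen link vanishes, so the hypothesis forces
`t = topDeg` on the frozen links: the TOP window chain.) One-directional: a vanishing window chain decides nothing.
[this file] -/
theorem kiPer_hits_of_window_ne_zero (l : List (W2Link m)) (hl : (l.map W2Link.blk).Nodup)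
    (W : Finset (Fin 3 → Fin (qOf m))) (hW : 2 * W.card < m * m) (t : W2Link m → ℕ)
    (ht : ∀ L ∈ l, topDeg L ≤ t L) (u v : Fin 2 → ℂ) (hE : chainVal ((window W t l).map W2Link.mat) u v ≠ 0) :
    bind₁ (kiPer m) (chainVal (l.map W2Link.mat) u v) ≠ 0 := by
  obtain ⟨b, hb⟩ := exists_coeff_ne_zero hE
  have hbW : ∀ c, c ∉ W → b c = 0 := fun c hc => by
    by_contra h
    exact hb (coeff_window_eq_zero W t hc l hl u v b h)
  have ha : b + frozenExp W t l ∈ (chainVal (l.map W2Link.mat) u v).support := by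
    rw [mem_support_iff, coeff_add_frozenExp W t l hl u v b hbW]
    exact hb
  refine kiPer_hits_of_shallow_monomial m ha (lt_of_le_of_lt (Nat.mul_le_mul_left 2 (Finset.card_le_card ?_)) hW)
  intro c hc
  rw [Finset.mem_filter] at hc
  by_contra hcW
  obtain ⟨L, hL, rfl⟩ : ∃ L ∈ l, W2Link.blk L = c :=
    List.mem_map.1 (mem_supported.1 (chainVal_mem_supported l u v) (Finset.mem_coe.2 hc.1))
  have h2 := hc.2
  rw [Finsupp.add_apply, hbW _ hcW, zero_add, frozenExp_apply_blk hl hL hcW] at h2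
  exact absurd (lt_of_lt_of_le h2 (degreeOf_blk_le_topDeg hl u v hL)) (not_lt.2 (ht L hL))
/-- **K1 quantifier shape**: for every window size `w`, every `m > 2w` (so some `m ≥ m₀`) hits every width-2 read-once chain
with a nonzero window chain over `≤ w` live blocks; contains the support rung for chains (`N ≤ w`, window = everything).
[this file] -/
theorem kiPer_hits_window_eventually (w m₀ : ℕ) : ∃ m, m₀ ≤ m ∧
    ∀ (l : List (W2Link m)), (l.map W2Link.blk).Nodup → ∀ (W : Finset (Fin 3 → Fin (qOf m))), W.card ≤ w →
      ∀ (t : W2Link m → ℕ), (∀ L ∈ l, topDeg L ≤ t L) → ∀ (u v : Fin 2 → ℂ),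
        chainVal ((window W t l).map W2Link.mat) u v ≠ 0 → bind₁ (kiPer m) (chainVal (l.map W2Link.mat) u v) ≠ 0 := by
  refine ⟨m₀ + 2 * w + 1, by omega, fun l hl W hWw t ht u v hE => kiPer_hits_of_window_ne_zero l hl W ?_ t ht u v hE⟩
  have h1 : 2 * W.card < 2 * w + 1 := by omega
  exact lt_of_lt_of_le h1 (le_trans (by omega) (Nat.le_mul_self _))

/-! ## 5. The scalar-top class `∏ (z_{c_j}·I + N_j)` -/
/-- A scalar-top link `z·I + N` has top degree `≤ 1`. [this file] -/
theorem topDeg_le_one_of_scalarTop {L : W2Link m}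
    (hs : L.M = (Polynomial.X : ℂ[X]) • (1 : Matrix (Fin 2) (Fin 2) ℂ[X]) + (constMat L).map Polynomial.C) : topDeg L ≤ 1 := by
  unfold topDeg
  refine Finset.sup_le fun ik _ => ?_
  rw [hs]
  simp only [Matrix.add_apply, Matrix.smul_apply, Matrix.map_apply, Matrix.one_apply, smul_eq_mul, mul_ite, mul_one,
    mul_zero]
  split_ifs
  · exact (Polynomial.natDegree_X_add_C _).le
  · rw [zero_add, Polynomial.natDegree_C]
    exact Nat.zero_le _
/-- The level-1 coefficient link of a scalar-top link has constant-term matrix `I`. [this file] -/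
theorem constMat_lead_one_of_scalarTop {L : W2Link m}
    (hs : L.M = (Polynomial.X : ℂ[X]) • (1 : Matrix (Fin 2) (Fin 2) ℂ[X]) + (constMat L).map Polynomial.C) :
    constMat (lead 1 L) = 1 := by
  rw [constMat_lead, hs]
  ext i k
  simp only [Matrix.map_apply, Matrix.add_apply, Matrix.smul_apply, Matrix.one_apply]
  split_ifs <;> simp
/-- The window skeleton of a scalar-top chain off the live block is `v` itself. [this file] -/
theorem skel_window_of_notMem {c : Fin 3 → Fin (qOf m)} {v : Fin 2 → ℂ} : ∀ {l : List (W2Link m)},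
    (∀ L ∈ l, L.M = (Polynomial.X : ℂ[X]) • (1 : Matrix (Fin 2) (Fin 2) ℂ[X]) + (constMat L).map Polynomial.C) →
      c ∉ l.map W2Link.blk → skel (window {c} (fun _ => 1) l) v = v
  | [], _, _ => skel_nil v
  | L :: _, hs, hc => by
    rw [List.map_cons, List.mem_cons, not_or] at hc
    have hcL : L.blk ∉ ({c} : Finset (Fin 3 → Fin (qOf m))) := fun h => hc.1 (Finset.mem_singleton.1 h).symm
    rw [window_cons, if_neg hcL, skel_cons, constMat_lead_one_of_scalarTop (hs L (List.mem_cons.2 (Or.inl rfl))),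
      Matrix.one_mulVec,
      skel_window_of_notMem (fun L' hL' => hs L' (List.mem_cons.2 (Or.inr hL'))) hc.2]
/-- The window skeleton of a scalar-top chain over the block of `L₀` is `N_{L₀}·v`. [this file] -/
theorem skel_window_of_mem {L₀ : W2Link m} {v : Fin 2 → ℂ} : ∀ {l : List (W2Link m)},
    (∀ L ∈ l, L.M = (Polynomial.X : ℂ[X]) • (1 : Matrix (Fin 2) (Fin 2) ℂ[X]) + (constMat L).map Polynomial.C) →
      (l.map W2Link.blk).Nodup → L₀ ∈ l → skel (window {L₀.blk} (fun _ => 1) l) v = (constMat L₀).mulVec v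
  | [], _, _, h => nomatch h
  | L :: _, hs, hl, hL₀ => by
    rw [List.map_cons, List.nodup_cons] at hl
    rw [window_cons, skel_cons]
    rcases List.mem_cons.1 hL₀ with rfl | h
    · rw [if_pos (Finset.mem_singleton_self _),
        skel_window_of_notMem (fun L' hL' => hs L' (List.mem_cons.2 (Or.inr hL'))) hl.1]
    · have hne : L.blk ∉ ({L₀.blk} : Finset (Fin 3 → Fin (qOf m))) := fun h' =>
        hl.1 (by rw [Finset.mem_singleton.1 h']; exact List.mem_map.2 ⟨L₀, h, rfl⟩)
      rw [if_neg hne, constMat_lead_one_of_scalarTop (hs L (List.mem_cons.2 (Or.inl rfl))), Matrix.one_mulVec,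
        skel_window_of_mem (fun L' hL' => hs L' (List.mem_cons.2 (Or.inr hL'))) hl.2 h]
/-- ★ **SCALAR-TOP CHAINS ARE HIT AS SOON AS ONE `uᵀ N_j v ≠ 0`** (`m ≥ 2`; the cell-(β) example class): every width-2
read-once chain `uᵀ · ∏_j (z_{c_j}·I + N_j) · v` (distinct blocks, any `N_j ∈ ℂ^{2×2}`, order, length, boundary vectors) with
`uᵀ N_{j₀} v ≠ 0` for some link is hit by `G_m` — window = the block of that link, window chain `= uᵀ(z·I + N_{j₀})v`. For
nilpotent `N_j` the constant skeleton of such a chain stalls on both sides. [this file] -/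
theorem kiPer_hits_scalarTop (hm : 2 ≤ m) (l : List (W2Link m)) (hl : (l.map W2Link.blk).Nodup)
    (hs : ∀ L ∈ l, L.M = (Polynomial.X : ℂ[X]) • (1 : Matrix (Fin 2) (Fin 2) ℂ[X]) + (constMat L).map Polynomial.C)
    {L₀ : W2Link m} (hL₀ : L₀ ∈ l) (u v : Fin 2 → ℂ) (h0 : dotProduct u ((constMat L₀).mulVec v) ≠ 0) :
    bind₁ (kiPer m) (chainVal (l.map W2Link.mat) u v) ≠ 0 := by
  refine kiPer_hits_of_window_ne_zero l hl {L₀.blk} ?_ (fun _ => 1)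
    (fun L hL => topDeg_le_one_of_scalarTop (hs L hL)) u v fun hE => h0 ?_
  · have h4 := Nat.mul_le_mul hm hm
    rw [Finset.card_singleton]
    omega
  · have h1 := congrArg constantCoeff hE
    rw [chainVal_eq_col, map_add, map_mul, map_mul, constantCoeff_C, constantCoeff_C, constantCoeff_col,
      constantCoeff_col, skel_window_of_mem hs hl hL₀, map_zero] at h1
    rw [dotProduct, Fin.sum_univ_two]
    exact h1

end Summit.ValiantsHypothesis.ValiantsHypothesis.Theorems.DefinabilityGapWindowCorner

end
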